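import Mathlib
import HarnessLib
import Literature.Analysis.FluidPDE.TaoLocalisationHolds
import Literature.Analysis.FluidPDE.TaoLocalisationProofs
import Summits.NavierStokesRegularity.NavierStokesRegularity.Theorems.AdiabaticEddyFrozenEddyAxisymNoSwirl
import Summits.NavierStokesRegularity.NavierStokesRegularity.Theorems.AdiabaticEddySteadyEulerDegenerateDirection

/-!
# Axisymmetric frozen-eddy collapse: on-axis centre ⇒ swirl-free profile, off-axis centre ⇒ no profile

(crux stmt-NavierStokesRegularity-1430 / kill stmt-NavierStokesRegularity-1431)

Route AdiabaticEddy.  Completion of `AdiabaticEddyFrozenEddyAxisymNoSwirl` (BN2 of the crux notes) in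
the EXACT hypotheses of the kill crux `AdiabaticEddy.NoFrozenEddyCollapse` (classical solution on
`[0, T)`, Leray–Hopf from a rapidly decaying datum) plus axisymmetry of the slices:

* `bounded_subslab_of_lerayHopf` — the sub-slab `L^∞` bound the swirl maximum principle needs is
  DISCHARGED: Leray–Hopf energy bound + Tao 2013 (Cor. 11.1 + Thm. 5.4 (iv), in tree
  `tao2011_hasBoundedSobolevNormsOn_holds`) + Sobolev imbedding `H² ⊂ L^∞`
  (`linfty_bound_of_hasBoundedSobolevNormsOn_holds`).
* `noSwirl_of_axisymmetric_frozenEddyCollapse` — ON-AXIS centre path: the frozen profile is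
  axisymmetric and swirl-free (what is left of this case of the kill is the steady statement "a smooth
  compactly supported axisymmetric swirl-free steady Euler flow vanishes", Jiu–Xin as quoted in
  Domínguez-Vázquez–Enciso–Peralta-Salas, ARMA 2021, §1 — not in the tree).
* `horizontalCross_profile_eq_zero_of_axisymmetric`, `eq_zero_of_axisymmetric_frozenEddyCollapse_offAxis`
  — OFF-AXIS centre path (horizontal part converging to `(ζ₀, ζ₁) ≠ (0, 0)`, any `α > 0`): the swirl
  bound gives `ζ₀ U₁ − ζ₁ U₀ ≡ 0`, i.e. `⟪U, (−ζ₁, ζ₀, 0)⟫ ≡ 0`, and a compactly supported steady Euler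
  flow missing a direction vanishes (`eq_zero_of_steadyEuler_of_inner_eq_zero`): `U = 0`.  This case of
  the kill crux stmt-NavierStokesRegularity-1431 is thereby CLOSED.
-/

noncomputable section

-- the summit-side namespace repeats a component by design (D-0017)
set_option linter.dupNamespace false

namespace Summit.NavierStokesRegularity.NavierStokesRegularity.Theorems

open Filter Topology Set
open scoped InnerProductSpace
open Literature.Analysis.FluidPDE

open scoped ENNReal in
/-- **Sub-slab boundedness of the physical solution** (the hypothesis of the maximum principle,
discharged): a classical solution of the unforced system (`ν > 0`) on `ℝ³ × [0, T)` which is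
Leray–Hopf from a rapidly decaying datum is bounded on every closed sub-slab `[0, T'] × ℝ³`,
`0 < T' < T`.  The energy on `[0, T']` is bounded by the initial energy
(`IsLerayHopfOn.lintegral_enorm_sq_le`), so all Sobolev norms are bounded there (Tao 2013,
Cor. 11.1 + Cor. 4.3 + Thm. 5.4 (iv): `tao2011_hasBoundedSobolevNormsOn_holds`) and `H² ⊂ L^∞`
(Adams–Fournier Thm. 4.12: `linfty_bound_of_hasBoundedSobolevNormsOn_holds`).  Same chain as the
tree's `hasBoundedSobolevNormsOn_subslab`; restated to keep this module's imports light.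
[cite: Tao2011, Cor. 11.1 + Cor. 4.3 + Thm. 5.4 (iv)] -/
theorem bounded_subslab_of_lerayHopf {T ν : ℝ} (hν : 0 < ν)
    {u : ℝ → (EuclideanSpace ℝ (Fin 3)) → (EuclideanSpace ℝ (Fin 3))}
    {p : ℝ → (EuclideanSpace ℝ (Fin 3)) → ℝ}
    (hcl : IsClassicalNSSolutionOn (Ico 0 T) ν 0 u p) (hLH : IsLerayHopfOn T ν 0 (u 0) u)
    (hdec : HasRapidSpatialDecay (u 0)) :
    ∀ T' ∈ Ioo 0 T, ∃ V : ℝ, ∀ t ∈ Icc 0 T', ∀ x, ‖u t x‖ ≤ V := by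
  intro T' hT'
  have hcl' : IsClassicalNSSolutionOn (Icc 0 T') ν 0 u p :=
    hcl.mono (Icc_subset_Ico_right hT'.2) (uniqueDiffOn_Icc hT'.1)
  have hEn : ∃ C : ℝ≥0∞, C < ⊤ ∧ ∀ t ∈ Icc 0 T', ∫⁻ x, ‖u t x‖ₑ ^ 2 ≤ C :=
    ⟨ENNReal.ofReal (2 * VectorCalculus.kineticEnergy (u 0)), ENNReal.ofReal_lt_top, fun t ht =>
      hLH.lintegral_enorm_sq_le hν.le ⟨ht.1, ht.2.trans hT'.2.le⟩⟩
  have hH : HasBoundedSobolevNormsOn (Icc 0 T') u :=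
    (tao2011_hasBoundedSobolevNormsOn.closedSlab tao2011_hasBoundedSobolevNormsOn_holds
      linfty_bound_of_hasBoundedSobolevNormsOn_holds ν T' hν hT'.1 u p hcl' hEn hdec).1
  exact linfty_bound_of_hasBoundedSobolevNormsOn_holds
    (fun t ht => (hcl'.contDiff_velocity ht).of_le (by norm_cast)) hH

/-- **No swirling (and only an axisymmetric) profile for an axisymmetric frozen-eddy collapse — in
the exact hypotheses of the kill crux.** Let `ν > 0`, `T > 0`, `(u, p)` a classical solution of the
unforced Navier–Stokes system on `ℝ³ × [0, T)`, Leray–Hopf from the rapidly decaying datum `u 0`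
(the hypotheses of `AdiabaticEddy.NoFrozenEddyCollapse`, stmt-NavierStokesRegularity-1431), whose
slices are AXISYMMETRIC about the `x₂`-axis.  If for some `α ∈ (1/2, 3/4)`, `ℓ > 0` and an ON-AXIS
centre path `ξ` the renormalised field `(T - t)^α • u t (ξ t + ℓ√(ν(T - t)) • y)` converges locally
uniformly to `U` as `t ↑ T`, then `U` is axisymmetric and swirl-free.  So in the axisymmetric class
the frozen eddy of `FrozenEddyCollapse` (stmt-1430) can only be a swirl-free axisymmetric compactly
supported steady Euler flow — an object believed not to exist (Jiu–Xin, as quoted in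
Domínguez-Vázquez–Enciso–Peralta-Salas, ARMA 2021, §1), which is the one remaining step of the
axisymmetric case of the kill.  Ingredients: swirl maximum principle (KNSS 2009 (1.9), Lei–Zhang 2017
(1.4): `abs_swirl_le_of_classical`), sub-slab boundedness (`bounded_subslab_of_lerayHopf`), and the
divergence of the circulation scale `A·L = (T - t)^{1/2-α} ℓ√ν`. [folklore] -/
theorem noSwirl_of_axisymmetric_frozenEddyCollapse {ν : ℝ} (hν : 0 < ν) {T : ℝ} (hT : 0 < T)
    {u : ℝ → (EuclideanSpace ℝ (Fin 3)) → (EuclideanSpace ℝ (Fin 3))}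
    {p : ℝ → (EuclideanSpace ℝ (Fin 3)) → ℝ} (hcl : IsClassicalNSSolutionOn (Ico 0 T) ν 0 u p)
    (hLH : IsLerayHopfOn T ν 0 (u 0) u) (hdec : HasRapidSpatialDecay (u 0))
    (haxi : ∀ t ∈ Ico 0 T, IsAxisymmetric (u t))
    {U : (EuclideanSpace ℝ (Fin 3)) → (EuclideanSpace ℝ (Fin 3))} {α : ℝ}
    (hα : α ∈ Ioo (1 / 2 : ℝ) (3 / 4)) {ℓ : ℝ} (hℓ : 0 < ℓ)
    {ξ : ℝ → (EuclideanSpace ℝ (Fin 3))} (hξ : ∀ t, ξ t 0 = 0 ∧ ξ t 1 = 0)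
    (hconv : TendstoLocallyUniformly
      (fun (t : ℝ) (y : (EuclideanSpace ℝ (Fin 3))) => ((T - t) ^ α) • u t (ξ t + (ℓ * Real.sqrt (ν * (T - t))) • y)) U
      (𝓝[<] T)) :
    IsAxisymmetric U ∧ HasNoSwirl U :=
  axisymmetric_frozenEddy_profile hν hT hcl hdec haxi (bounded_subslab_of_lerayHopf hν hcl hLH hdec)
    hα hℓ hξ hconv

/-- **Off-axis swirl consequence (pointwise).** Classical solution on `[0, T)` (`ν > 0`, `T > 0`) with
axisymmetric slices, velocity bounded on closed sub-slabs and bounded initial swirl; if the horizontal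
components of the centre path converge, `ξ₀(t) → ζ₀`, `ξ₁(t) → ζ₁`, and
`(T - t)^α • u t (ξ t + (ℓ√(ν(T - t))) • y) → v` as `t ↑ T` with `α > 0`, then `ζ₀ v₁ − ζ₁ v₀ = 0`:
`(T - t)^α Γ(t, x_t) = (ξ₀ + L y₀) F₁ − (ξ₁ + L y₁) F₀ → ζ₀ v₁ − ζ₁ v₀` while `|Γ| ≤ M`. [folklore] -/
theorem horizontalCross_profile_eq_zero_of_axisymmetric {T ν α ℓ : ℝ}
    {u : ℝ → (EuclideanSpace ℝ (Fin 3)) → (EuclideanSpace ℝ (Fin 3))} {p : ℝ → (EuclideanSpace ℝ (Fin 3)) → ℝ}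
    (hν : 0 < ν) (hT : 0 < T) (hcl : IsClassicalNSSolutionOn (Ico 0 T) ν 0 u p)
    (haxi : ∀ t ∈ Ico 0 T, IsAxisymmetric (u t))
    (hbdd : ∀ T' ∈ Ioo 0 T, ∃ V : ℝ, ∀ t ∈ Icc 0 T', ∀ x, ‖u t x‖ ≤ V)
    (hM : ∃ M : ℝ, ∀ x, |swirl (u 0) x| ≤ M) (hα : 0 < α)
    {ξ : ℝ → (EuclideanSpace ℝ (Fin 3))} {ζ₀ ζ₁ : ℝ} (hξ₀ : Tendsto (fun t => ξ t 0) (𝓝[<] T) (𝓝 ζ₀))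
    (hξ₁ : Tendsto (fun t => ξ t 1) (𝓝[<] T) (𝓝 ζ₁)) {y v : (EuclideanSpace ℝ (Fin 3))}
    (hconv : Tendsto (fun t => ((T - t) ^ α) • u t (ξ t + (ℓ * Real.sqrt (ν * (T - t))) • y))
      (𝓝[<] T) (𝓝 v)) :
    ζ₀ * v 1 - ζ₁ * v 0 = 0 := by
  obtain ⟨M, hM⟩ := hM
  have hΓ := abs_swirl_le_of_classical_Ico hν hcl haxi hbdd hM
  set L : ℝ → ℝ := fun t => ℓ * Real.sqrt (ν * (T - t)) with hL
  set x : ℝ → (EuclideanSpace ℝ (Fin 3)) := fun t => ξ t + (L t) • y with hx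
  set F : ℝ → (EuclideanSpace ℝ (Fin 3)) := fun t => ((T - t) ^ α) • u t (x t) with hF
  set G : ℝ → ℝ := fun t => (ξ t 0 + L t * y 0) * F t 1 - (ξ t 1 + L t * y 1) * F t 0 with hG
  have hswirl : ∀ t, (T - t) ^ α * swirl (u t) (x t) = G t := by
    intro t
    have hx0 : x t 0 = ξ t 0 + L t * y 0 := by
      simp only [hx, PiLp.add_apply, PiLp.smul_apply, smul_eq_mul]
    have hx1 : x t 1 = ξ t 1 + L t * y 1 := by
      simp only [hx, PiLp.add_apply, PiLp.smul_apply, smul_eq_mul]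
    have hF0 : F t 0 = (T - t) ^ α * u t (x t) 0 := by simp only [hF, PiLp.smul_apply, smul_eq_mul]
    have hF1 : F t 1 = (T - t) ^ α * u t (x t) 1 := by simp only [hF, PiLp.smul_apply, smul_eq_mul]
    simp only [swirl, hG, hx0, hx1, hF0, hF1]
    ring
  -- `L t → 0`
  have hLlim : Tendsto L (𝓝[<] T) (𝓝 0) := by
    have hc : Continuous L := by
      simp only [hL]
      exact continuous_const.mul (Real.continuous_sqrt.comp (continuous_const.mul
        (continuous_const.sub continuous_id)))
    have h' : Tendsto L (𝓝[<] T) (𝓝 (L T)) := (hc.tendsto T).mono_left nhdsWithin_le_nhds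
    simpa [hL] using h'
  -- `G t → ζ₀ v₁ − ζ₁ v₀`
  have hconvF : Tendsto F (𝓝[<] T) (𝓝 v) := hconv
  have h1 : Tendsto (fun t => F t 1) (𝓝[<] T) (𝓝 (v 1)) :=
    ((PiLp.continuous_apply 2 _ 1).tendsto v).comp hconvF
  have h0 : Tendsto (fun t => F t 0) (𝓝[<] T) (𝓝 (v 0)) :=
    ((PiLp.continuous_apply 2 _ 0).tendsto v).comp hconvF
  have hG1 : Tendsto G (𝓝[<] T) (𝓝 ((ζ₀ + 0 * y 0) * v 1 - (ζ₁ + 0 * y 1) * v 0)) :=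
    ((hξ₀.add (hLlim.mul_const _)).mul h1).sub ((hξ₁.add (hLlim.mul_const _)).mul h0)
  simp only [zero_mul, add_zero] at hG1
  -- `G t → 0`
  have hG0 : Tendsto G (𝓝[<] T) (𝓝 0) := by
    have hbound : ∀ᶠ t in 𝓝[<] T, ‖G t‖ ≤ M * (T - t) ^ α := by
      filter_upwards [Ico_mem_nhdsLT hT] with t ht
      have hTt : 0 < T - t := sub_pos.2 ht.2
      rw [Real.norm_eq_abs, ← hswirl t, abs_mul, abs_of_nonneg (Real.rpow_nonneg hTt.le α),
        mul_comm]
      exact mul_le_mul_of_nonneg_right (hΓ t ht (x t)) (Real.rpow_nonneg hTt.le α)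
    have hlim : Tendsto (fun t => M * (T - t) ^ α) (𝓝[<] T) (𝓝 0) := by
      simpa using (tendsto_rpow_nhdsLT_zero (T := T) hα).const_mul M
    exact squeeze_zero_norm' hbound hlim
  exact tendsto_nhds_unique hG1 hG0

/-- **Axisymmetric frozen-eddy collapse with an off-axis centre is impossible.** Let `ν > 0`, `T > 0`,
`(u, p)` a classical solution of the unforced Navier–Stokes system on `ℝ³ × [0, T)`, Leray–Hopf from the
rapidly decaying datum `u 0`, with AXISYMMETRIC slices; let `U` be a smooth compactly supported steady
Euler flow (pressure `P`) — the hypotheses of `AdiabaticEddy.NoFrozenEddyCollapse`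
(stmt-NavierStokesRegularity-1431; incompressibility of `U` is not even needed).  If the renormalised
field `(T - t)^α • u t (ξ t + ℓ√(ν(T - t)) • y)` (`α > 0`) converges locally uniformly to `U` as `t ↑ T`
along a centre path whose horizontal components converge to `(ζ₀, ζ₁) ≠ (0, 0)`, then `U = 0`.
Proof: `ζ₀ U₁ − ζ₁ U₀ ≡ 0` (`horizontalCross_profile_eq_zero_of_axisymmetric`, sub-slab bound from
`bounded_subslab_of_lerayHopf`), i.e. `⟪U, (−ζ₁, ζ₀, 0)⟫ ≡ 0`, and
`eq_zero_of_steadyEuler_of_inner_eq_zero`.  (In the axisymmetric class a singularity off the axis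
would be a circle of singular points, excluded for suitable weak solutions by CKN; this is an
elementary route for the frozen-eddy scenario.) [folklore] -/
theorem eq_zero_of_axisymmetric_frozenEddyCollapse_offAxis {ν : ℝ} (hν : 0 < ν) {T : ℝ} (hT : 0 < T)
    {u : ℝ → (EuclideanSpace ℝ (Fin 3)) → (EuclideanSpace ℝ (Fin 3))}
    {p : ℝ → (EuclideanSpace ℝ (Fin 3)) → ℝ} (hcl : IsClassicalNSSolutionOn (Ico 0 T) ν 0 u p)
    (hLH : IsLerayHopfOn T ν 0 (u 0) u) (hdec : HasRapidSpatialDecay (u 0))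
    (haxi : ∀ t ∈ Ico 0 T, IsAxisymmetric (u t))
    {U : (EuclideanSpace ℝ (Fin 3)) → (EuclideanSpace ℝ (Fin 3))} {P : (EuclideanSpace ℝ (Fin 3)) → ℝ}
    (hU : ContDiff ℝ (⊤ : ℕ∞) U) (hP : ContDiff ℝ (⊤ : ℕ∞) P)
    (hUc : HasCompactSupport U) (hEul : ∀ x, convect U U x + gradient P x = 0)
    {α : ℝ} (hα : 0 < α) {ℓ : ℝ} {ξ : ℝ → (EuclideanSpace ℝ (Fin 3))} {ζ₀ ζ₁ : ℝ}
    (hξ₀ : Tendsto (fun t => ξ t 0) (𝓝[<] T) (𝓝 ζ₀))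
    (hξ₁ : Tendsto (fun t => ξ t 1) (𝓝[<] T) (𝓝 ζ₁)) (hζ : ζ₀ ≠ 0 ∨ ζ₁ ≠ 0)
    (hconv : TendstoLocallyUniformly
      (fun (t : ℝ) (y : (EuclideanSpace ℝ (Fin 3))) => ((T - t) ^ α) • u t (ξ t + (ℓ * Real.sqrt (ν * (T - t))) • y)) U
      (𝓝[<] T)) :
    U = 0 := by
  have hbdd := bounded_subslab_of_lerayHopf hν hcl hLH hdec
  have hM := exists_abs_swirl_le_of_hasRapidSpatialDecay hdec
  have hcross : ∀ y, ζ₀ * U y 1 - ζ₁ * U y 0 = 0 := fun y =>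
    horizontalCross_profile_eq_zero_of_axisymmetric hν hT hcl haxi hbdd hM hα hξ₀ hξ₁
      (hconv.tendstoLocallyUniformlyOn.tendsto_at (mem_univ y))
  set e : (EuclideanSpace ℝ (Fin 3)) := WithLp.toLp 2 ![-ζ₁, ζ₀, 0] with he
  have he0 : e ≠ 0 := by
    intro h
    have h0 : e 0 = (0 : (EuclideanSpace ℝ (Fin 3))) 0 := by rw [h]
    have h1 : e 1 = (0 : (EuclideanSpace ℝ (Fin 3))) 1 := by rw [h]
    simp [he] at h0 h1
    rcases hζ with h | h
    · exact h h1
    · exact h h0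
  have hUe : ∀ x, ⟪U x, e⟫_ℝ = 0 := fun x => by
    have := hcross x
    simp [he, PiLp.inner_apply, Fin.sum_univ_three]
    linarith
  exact eq_zero_of_steadyEuler_of_inner_eq_zero (hU.of_le (by norm_cast)) hUc
    (hP.differentiable (by simp)) hEul he0 hUe

end Summit.NavierStokesRegularity.NavierStokesRegularity.Theorems

end
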